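import Mathlib
import HarnessLib
import Summits.ValiantsHypothesis.ValiantsHypothesis.Theorems.KPlusLogSqLawWeakLiftingTowerGraftInflectionLaw
import Summits.ValiantsHypothesis.ValiantsHypothesis.Theorems.KPlusLogSqLawWeakLiftingTowerGraftCausalDescartes
import Summits.ValiantsHypothesis.ValiantsHypothesis.Theorems.KPlusLogSqLawWeakLiftingTowerGraftRankOnePencils

/-!
# Tower graft line — THE SIZE-ONE SECTOR OF THE INFLECTION CLASS LAW: log–log inflections of a fewnomial

Helper file for LINE (B) `Cruxes/WeakLifting/Lines/tower_graft.lean` (crux `WeakLifting` = stmt-ValiantsHypothesis-19561; rung S4b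
`TowerGraftLawCorner`).  NO stub is claimed.  It continues `…TowerGraftInflectionLaw` / `…InflectionLawCorner` (hand g8, p824427 /
p824596 / p824646), which reduced S4b — format by format — to an INFLECTION CLASS LAW «`Z₊(𝓘(det G, det G₀₀)) ≤ 2^c·B + 2^{c·log₂²(m+1)}`»
for the `D`-free inflection polynomial `𝓘(A,E) = W(A·E, X·W(E,A))`, and named its first sector: size `m + 1 = 1`, where `det G = g` is a
`K`-nomial and `det G₀₀ = 1`, i.e. «a linear bound for the log–log inflections of a `K`-nomial».  This file puts that sector in the kernel.

* `inflection_one` — at `E = 1` the inflection polynomial is `𝓘(A,1) = W(A, θA)`, `θ = X·d/dX` (δ).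
* `X_mul_inflection_one_eq`, `two_mul_X_mul_inflection_one_eq` — **PAIR-SUM FORM**: for `A = Σₗ sₗ X^{dₗ}`,
  `2·X·W(A, θA) = Σₗ Σₗ' sₗ sₗ' (dₗ − dₗ')² · X^{dₗ + dₗ'}`
  (the polynomial form of `u u″ − u′² = ½ Σ sₗ sₗ' (dₗ − dₗ')² e^{(dₗ+dₗ')x}` for the exponential sum `u(x) = A(eˣ)`): the log–log curvature
  of a fewnomial is a fewnomial on the PAIR SUMS of its support with coefficients `sₗ sₗ' (dₗ − dₗ')²`.
* `card_posRoots_inflection_one_eq_zero_of_nonneg` — one-signed coefficients ⇒ NO positive zero of `W(A, θA)` (posinomials are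
  log–log convex; the size-one inflection class law with constant `0` on the Descartes-trivial class).
* `card_posRoots_inflection_one_le` — **SIGN-STRUCTURE CEILING** `Z₊(W(A, θA)) ≤ 2·p·n`, `p = #{sₗ > 0}`, `n = #{sₗ < 0}` (the tree's
  `card_posRoots_le_two_mul_card_negCoeff`, two zeros per negative coefficient, applied to the pair-sum form: a negative pair-sum
  coefficient needs a pair of opposite signs).  So a `K`-nomial with ONE coefficient of minority sign has `≤ 2(K − 1)` log–log inflections —
  the LINEAR shape the class law asks for (`B ≥ K − 1` at size one by `DescartesSharp`) — while the general ceiling is quadratic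
  (`p·n ≤ K²/4`; on a 2-tower all pair sums are distinct and the pair-sum sign sequence can alternate `≈ K²/4` times).

READING FOR THE LINE (honest).  The size-one inflection class law «`Z₊(W(g, θg)) ≤ 2^c (K − 1) + 2^c` for every real `K`-nomial `g`» is
EXACTLY the question «how many critical points has the logarithmic derivative `θg/g` of a `K`-nomial on `(0, ∞)`» (zeros of `W(g,θg)` off
`Z(g)` are the critical points of `θg/g`; equivalently the parameters `ν` at which the EULER PENCIL `ν·g − θg` — `K`-nomials on the SAME
support, coefficients `sₗ(ν − dₗ)` changing sign one at a time — acquires a double positive root).  Descartes decides it only for bounded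
sign complexity (this file); it is open in general, with the same «tropically linear / Descartes quadratic» signature as the `m = 2` row
(`…TowerGraftRowTwoRung`, the `fg + 1` question).  LOCATED (this seat, scratch `trop_pairs.py`, `level2.py`, `verify_trop.py`; not typed):
in the scale-separated (Viro) regime the dominant pair of `Σ sₗsₗ'(dₗ−dₗ')² X^{dₗ+dₗ'}` is the TOP-TWO pair of the line arrangement
`{αₗ + dₗ·x}` (`αₗ = log|sₗ|`), so tropical sign alternations are changes of the 2-set of a line arrangement: at most `⌊(3K − 5)/2⌋` for
pseudoline arrangements (`K ≤ 8`, dynamic programme over reduced words of the longest permutation), hence LINEAR; and the naive guess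
«`≤ K − 1`» is FALSE: on the 2-tower `(0,1,3,20,135,1000)` the 6-nomial with `log|s| ≈ λ·(−13.63, −2.83, 20.40, 1.39, −0.36, −42.78)`,
signs `(+,−,+,+,−,+)` has `6 > K − 1 = 5` log–log inflections for every `λ ∈ {1,2,4,8,16}` (sign certificate on a grid; dominant-pair sequence
`01,02,12,23,24,25,45`).  Nothing here bounds the general case.

HONEST FRAMING: Descartes-zone bookkeeping of ONE sector of a reduction; nothing on S4/S4b/S4d/S4f/S5/S5ᴸ, TowerB, `WeakLifting`,
Conjecture B, `MatrixDescartes` (18050) or `VP ≠ VNP`.  Def-free; Mathlib + the two tree files imported.  Seat: prover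
leafhand-val-kpluslogsqlaw-1 g9, `--supports stmt-ValiantsHypothesis-19561 --as helper`.  [folklore: log-convexity of exponential sums with
positive coefficients; Descartes' rule for exponential sums (Pólya–Szegő, Problems and Theorems in Analysis II, Part V, §1); the pair-sum
packaging and the sign-structure ceiling for `W(A, θA)` are this work]
-/

-- `Summit.ValiantsHypothesis.ValiantsHypothesis.…` repeats a component by the D-0017 layout
-- (single-conjunct summit), which the `dupNamespace` linter flags; the name is mandated.
set_option linter.dupNamespace false
set_option autoImplicit false

namespace Summit.ValiantsHypothesis.ValiantsHypothesis.Theorems.KPlusLogSqLaw.TowerGraft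

open Polynomial Finset
open scoped BigOperators Polynomial

namespace InflectionLaw

/-- At `E = 1` the inflection polynomial `𝓘(A,E) = W(A·E, X·W(E,A))` of `…TowerGraftInflectionLaw` is `W(A, θA)` with
`θA = X·A′` the Euler derivative. [this work] -/
theorem inflection_one (A : ℝ[X]) :
    wronskian (A * 1) (X * wronskian 1 A) = wronskian A (X * derivative A) := by
  simp [wronskian]

/-- Euler derivative of a fewnomial `A = Σₗ sₗ X^{dₗ}`: `θA = Σₗ sₗ dₗ X^{dₗ}` — same support (the monomial case
`X·(X^n)′ = n·X^n` is the tree's `Literature.Analysis.FluidPDE.Elgindi.X_mul_derivative_X_pow`; inlined here to keep the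
imports inside the line). [folklore] -/
theorem X_mul_derivative_fewnomial {K : ℕ} (s : Fin K → ℝ) (d : Fin K → ℕ) :
    (X : ℝ[X]) * derivative (∑ l, C (s l) * X ^ d l) = ∑ l, C (s l * d l) * X ^ d l := by
  rw [derivative_sum, Finset.mul_sum]
  refine Finset.sum_congr rfl fun l _ => ?_
  have hmono : (X : ℝ[X]) * derivative (X ^ d l) = C (d l : ℝ) * X ^ d l := by
    rcases Nat.eq_zero_or_pos (d l) with h0 | hpos
    · rw [h0]; simp
    · obtain ⟨n, hn⟩ : ∃ n, d l = n + 1 := ⟨d l - 1, by omega⟩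
      rw [hn, derivative_X_pow, Nat.add_sub_cancel, pow_succ]
      push_cast
      ring
  rw [derivative_C_mul, ← mul_assoc, mul_comm X (C (s l)), mul_assoc, hmono, map_mul]
  ring

/-- **Pair-sum form of the size-one inflection polynomial.**  For a fewnomial `A = Σₗ sₗ X^{dₗ}`:
`X·W(A, θA) = A·θ²A − (θA)² = Σₗ Σₗ' sₗ sₗ' (dₗ'² − dₗ dₗ') X^{dₗ + dₗ'}`. [this work] -/
theorem X_mul_inflection_one_eq {K : ℕ} (s : Fin K → ℝ) (d : Fin K → ℕ) :
    (X : ℝ[X]) * wronskian (∑ l, C (s l) * X ^ d l) (X * derivative (∑ l, C (s l) * X ^ d l)) =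
      ∑ l, ∑ l', C (s l * s l' * ((d l' : ℝ) * d l' - d l * d l')) * X ^ (d l + d l') := by
  have hθ := X_mul_derivative_fewnomial s d
  have hθθ : (X : ℝ[X]) * derivative (X * derivative (∑ l, C (s l) * X ^ d l)) =
      ∑ l, C (s l * d l * d l) * X ^ d l := by
    rw [hθ, X_mul_derivative_fewnomial (fun l => s l * d l) d]
  calc (X : ℝ[X]) * wronskian (∑ l, C (s l) * X ^ d l) (X * derivative (∑ l, C (s l) * X ^ d l))
      = (∑ l, C (s l) * X ^ d l) * (X * derivative (X * derivative (∑ l, C (s l) * X ^ d l))) -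
          (X * derivative (∑ l, C (s l) * X ^ d l)) * (X * derivative (∑ l, C (s l) * X ^ d l)) := by
        unfold wronskian; ring
    _ = ∑ l, ∑ l', C (s l * s l' * ((d l' : ℝ) * d l' - d l * d l')) * X ^ (d l + d l') := by
        rw [hθθ, hθ, Finset.sum_mul_sum, Finset.sum_mul_sum, ← Finset.sum_sub_distrib]
        refine Finset.sum_congr rfl fun l _ => ?_
        rw [← Finset.sum_sub_distrib]
        refine Finset.sum_congr rfl fun l' _ => ?_
        simp only [map_mul, map_sub, pow_add]
        ring

/-- **Symmetric pair-sum form:** `2·X·W(A, θA) = Σₗ Σₗ' sₗ sₗ' (dₗ − dₗ')² X^{dₗ + dₗ'}` — the log–log curvature of a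
fewnomial is a fewnomial on the PAIR SUMS of its support, with coefficients `sₗ sₗ' (dₗ − dₗ')²`. [this work; the underlying
identity `u u″ − u′² = ½ Σ sₗ sₗ' (dₗ − dₗ')² e^{(dₗ+dₗ')x}` for exponential sums is folklore] -/
theorem two_mul_X_mul_inflection_one_eq {K : ℕ} (s : Fin K → ℝ) (d : Fin K → ℕ) :
    2 * ((X : ℝ[X]) * wronskian (∑ l, C (s l) * X ^ d l) (X * derivative (∑ l, C (s l) * X ^ d l))) =
      ∑ l, ∑ l', C (s l * s l' * ((d l : ℝ) - d l') ^ 2) * X ^ (d l + d l') := by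
  rw [two_mul, X_mul_inflection_one_eq]
  conv_lhs =>
    enter [1]
    rw [Finset.sum_comm]
  rw [← Finset.sum_add_distrib]
  refine Finset.sum_congr rfl fun l _ => ?_
  rw [← Finset.sum_add_distrib]
  refine Finset.sum_congr rfl fun l' _ => ?_
  rw [add_comm (d l') (d l), ← add_mul, ← map_add]
  congr 1
  congr 1
  ring

/-- the positive zeros of `X·P` are those of `P`. [folklore] -/
theorem card_posRoots_X_mul (P : ℝ[X]) :
    ((X * P).roots.toFinset.filter (fun x => 0 < x)).card = (P.roots.toFinset.filter (fun x => 0 < x)).card := by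
  classical
  by_cases hP : P = 0
  · simp [hP]
  rw [roots_mul (mul_ne_zero X_ne_zero hP), roots_X, Multiset.toFinset_add, Finset.filter_union]
  have : (({(0 : ℝ)} : Multiset ℝ).toFinset.filter fun x => 0 < x) = ∅ := by
    simp
  rw [this, Finset.empty_union]

/-- **Posinomials have no log–log inflections** (size-one inflection class law, one-signed case): if every coefficient
`sₗ ≥ 0` then `W(A, θA)` has NO positive zero (it is either `0` or positive on `(0, ∞)`). [folklore: log–log convexity of
posinomials; kernel form this work] -/
theorem card_posRoots_inflection_one_eq_zero_of_nonneg {K : ℕ} (s : Fin K → ℝ) (d : Fin K → ℕ)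
    (hs : ∀ l, 0 ≤ s l) :
    ((wronskian (∑ l, C (s l) * X ^ d l) (X * derivative (∑ l, C (s l) * X ^ d l))).roots.toFinset.filter
      (fun x => 0 < x)).card = 0 := by
  classical
  set W := wronskian (∑ l, C (s l) * X ^ d l) (X * derivative (∑ l, C (s l) * X ^ d l)) with hWdef
  by_cases hW : W = 0
  · simp [hW]
  rw [Finset.card_eq_zero, Finset.filter_eq_empty_iff]
  intro t ht htpos
  rw [Multiset.mem_toFinset, mem_roots hW] at ht
  have hid := two_mul_X_mul_inflection_one_eq s d
  rw [← hWdef] at hid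
  -- evaluate the identity at `t`: every term is nonnegative and the sum vanishes
  have heval : ∑ l, ∑ l', s l * s l' * ((d l : ℝ) - d l') ^ 2 * t ^ (d l + d l') = 0 := by
    have h := congrArg (Polynomial.eval t) hid
    simp only [eval_mul, eval_ofNat, eval_X, ht.eq_zero, mul_zero, eval_finsetSum, eval_C, eval_pow] at h
    exact h.symm
  have hterm : ∀ l l', s l * s l' * ((d l : ℝ) - d l') ^ 2 * t ^ (d l + d l') = 0 := by
    have hnn : ∀ l l', 0 ≤ s l * s l' * ((d l : ℝ) - d l') ^ 2 * t ^ (d l + d l') := fun l l' =>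
      mul_nonneg (mul_nonneg (mul_nonneg (hs l) (hs l')) (sq_nonneg _)) (pow_nonneg htpos.le _)
    intro l l'
    have h1 := (Finset.sum_eq_zero_iff_of_nonneg (fun l _ => Finset.sum_nonneg fun l' _ => hnn l l')).mp heval l
      (Finset.mem_univ _)
    exact (Finset.sum_eq_zero_iff_of_nonneg (fun l' _ => hnn l l')).mp h1 l' (Finset.mem_univ _)
  have hcoef : ∀ l l', s l * s l' * ((d l : ℝ) - d l') ^ 2 = 0 := by
    intro l l'
    have h := hterm l l'
    rcases mul_eq_zero.mp h with h | h
    · exact h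
    · exact absurd h (pow_ne_zero _ htpos.ne')
  have hzero : 2 * ((X : ℝ[X]) * W) = 0 := by
    rw [hid]
    exact Finset.sum_eq_zero fun l _ => Finset.sum_eq_zero fun l' _ => by rw [hcoef l l', map_zero, zero_mul]
  rcases mul_eq_zero.mp hzero with h | h
  · norm_num at h
  · exact hW ((mul_eq_zero.mp h).resolve_left X_ne_zero)

/-- **Size-one inflection count by SIGN STRUCTURE** (Descartes on the pair-sum form, two zeros per negative pair):
`Z₊(W(A, θA)) ≤ 2·p·n` where `p = #{l : sₗ > 0}` and `n = #{l : sₗ < 0}`.  In particular a `K`-nomial with ONE coefficient of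
minority sign has at most `2(K − 1)` log–log inflections — the linear (class-budget) shape of the size-one inflection class law —
while the general Descartes ceiling is quadratic (`p·n ≤ K²/4` negative pair sums). [this work; via the tree's
`card_posRoots_le_two_mul_card_negCoeff`] -/
theorem card_posRoots_inflection_one_le {K : ℕ} (s : Fin K → ℝ) (d : Fin K → ℕ) :
    ((wronskian (∑ l, C (s l) * X ^ d l) (X * derivative (∑ l, C (s l) * X ^ d l))).roots.toFinset.filter
      (fun x => 0 < x)).card ≤
      2 * ((univ.filter fun l => 0 < s l).card * (univ.filter fun l => s l < 0).card) := by
  classical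
  set W := wronskian (∑ l, C (s l) * X ^ d l) (X * derivative (∑ l, C (s l) * X ^ d l)) with hWdef
  set Q : ℝ[X] := ∑ l, ∑ l', C (s l * s l' * ((d l : ℝ) - d l') ^ 2) * X ^ (d l + d l') with hQdef
  have hQ : Q = C 2 * (X * W) := by
    rw [hQdef, ← two_mul_X_mul_inflection_one_eq s d, ← hWdef, ← map_ofNat C 2]
  have hZ : (W.roots.toFinset.filter (fun x => 0 < x)).card = (Q.roots.toFinset.filter (fun x => 0 < x)).card := by
    rw [hQ, roots_C_mul _ two_ne_zero, card_posRoots_X_mul]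
  rw [hZ]
  refine (card_posRoots_le_two_mul_card_negCoeff Q).trans (Nat.mul_le_mul_left 2 ?_)
  -- every negative coefficient of `Q` sits at a pair sum `d a + d b` with `s a > 0 > s b`
  have hsub : Q.support.filter (fun k => Q.coeff k < 0) ⊆
      ((univ.filter fun a => 0 < s a) ×ˢ (univ.filter fun b => s b < 0)).image (fun ab => d ab.1 + d ab.2) := by
    intro k hk
    rw [Finset.mem_filter] at hk
    obtain ⟨-, hneg⟩ := hk
    by_contra hno
    refine absurd hneg (not_lt.mpr ?_)
    rw [hQdef, finsetSum_coeff]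
    refine Finset.sum_nonneg fun l _ => ?_
    rw [finsetSum_coeff]
    refine Finset.sum_nonneg fun l' _ => ?_
    rw [coeff_C_mul_X_pow]
    split_ifs with hke
    · rcases le_or_gt 0 (s l * s l') with hss | hss
      · exact mul_nonneg hss (sq_nonneg _)
      · exfalso
        refine hno (Finset.mem_image.mpr ?_)
        rcases mul_neg_iff.mp hss with ⟨hl, hl'⟩ | ⟨hl, hl'⟩
        · exact ⟨(l, l'), Finset.mem_product.mpr ⟨Finset.mem_filter.mpr ⟨Finset.mem_univ _, hl⟩,
            Finset.mem_filter.mpr ⟨Finset.mem_univ _, hl'⟩⟩, hke.symm⟩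
        · exact ⟨(l', l), Finset.mem_product.mpr ⟨Finset.mem_filter.mpr ⟨Finset.mem_univ _, hl'⟩,
            Finset.mem_filter.mpr ⟨Finset.mem_univ _, hl⟩⟩, by rw [add_comm]; exact hke.symm⟩
    · exact le_rfl
  calc (Q.support.filter fun k => Q.coeff k < 0).card
      ≤ (((univ.filter fun a => 0 < s a) ×ˢ (univ.filter fun b => s b < 0)).image
          (fun ab => d ab.1 + d ab.2)).card := Finset.card_le_card hsub
    _ ≤ ((univ.filter fun a => 0 < s a) ×ˢ (univ.filter fun b => s b < 0)).card := Finset.card_image_le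
    _ = (univ.filter fun l => 0 < s l).card * (univ.filter fun l => s l < 0).card := Finset.card_product _ _

/-! ## §2 (rev 2) General pencils: the Wronskian of two fewnomials and the NON-NESTING budget

The size-one inflection polynomial is the member `v = θu` of a wider class: the Wronskian `W(u,v)` of two `K`-nomials on a
common support `d`.  `X·W(u,v) = Σₐ Σ_b uₐ v_b (d_b − dₐ) X^{dₐ+d_b} = Σ_{a<b} P_{ab}(d_b − dₐ) X^{dₐ+d_b}` with the PLÜCKER
coordinates `P_{ab} = uₐ v_b − u_b vₐ` of the pencil; its positive zeros are the critical points of `u/v`, i.e. the parameters at which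
the pencil `u − ν v` meets the discriminant.  On the polynomial (dense) support `{0,…,K−1}` it has degree `≤ 2K − 4` after division by
`X`, so `Z₊ ≤ 2K − 4` there; Descartes on a 2-tower only gives `C(K,2) − 1`.

TROPICAL WRONSKIAN LAW (prose; the combinatorial half is `card_le_of_nonNesting` below).  Scale the coefficients (`log|P_{ab}| = λ·w_{ab}`,
`λ → ∞`, `w` a tropical Plücker vector, i.e. `w_{ab} = δ_T(a,b) + ωₐ + ω_b` for a tree metric `δ_T` — the four-point condition: for
`i<j<k<l` the maximum of `w_ij + w_kl`, `w_ik + w_jl`, `w_il + w_jk` is attained twice).  The dominant pair at `x = log t` is the vertex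
of the upper hull `f` of the points `(dₐ + d_b, w_{ab})`.  CLAIM: the hull vertices form a NON-NESTING family — no `i<j<k<l` with both
`(i,l)` and `(j,k)` vertices.  Indeed the three matchings of a quadruple have the same slope sum `dᵢ+dⱼ+d_k+d_l` and nested slope
intervals `[e_ij, e_kl] ⊃ [e_ik, e_jl] ⊃ [e_il ∧ e_jk, e_il ∨ e_jk]`; if `(i,l)` and `(j,k)` are vertices, strict concavity of `f` through
them gives `w_il + w_jk = f(e_il) + f(e_jk) > f(e_ik) + f(e_jl) ≥ w_ik + w_jl` and likewise `> w_ij + w_kl`: the maximum in the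
four-point condition would be attained once — impossible.  By `card_le_of_nonNesting` a non-nesting family of pairs on `K` letters has
at most `2K − 3` members, so the tropical Wronskian has at most `2K − 3` dominant pairs and at most `2K − 4` sign alternations — EXACTLY
the dense-support degree.  (With the gap weights `log(d_b − dₐ)` restored, nested vertices can occur only inside windows of bounded
width `log((d_l−dᵢ)(d_k−dⱼ)/((dⱼ−dᵢ)(d_l−d_k)))`, invisible after scaling.)  CONJECTURE recorded for the line (supported by the dense
case, the tropical law, and searches `K ≤ 6` on 2-towers which never exceeded `2K − 4`; e.g. `K = 4` on `(0,1,3,20)`: 4 found, Descartes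
allows 5): «`Z₊(W(u,v)) ≤ 2K − 4` for any two real `K`-nomials on a common support» — it would close the size-one sector with constant
`2` (`2K − 4 ≤ 2(K−1) ≤ 2B`).  The naive induction «`Z₊(W(u,v)) ≤ Z₊(W(u′,v′)) + 2` when `d₀ = 0`» is FALSE (located: `d = (0,1,3,20)`,
`u = (−1.799, 0.03175, −1.069, 0.5212)`, `v = (0.9431, −5.07, 3.209, −0.01255)`: `Z₊(W(u,v)) = 3` at `t ≈ 0.66, 1.03, 1.23`, exact rational
evaluation, while `W(u′,v′) = −31.9X⁴ + 1004.0X²¹ − 1692.3X²³` has no positive zero).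
-/

/-- **Pair-sum (Plücker) form of the Wronskian of two fewnomials** on a common support:
`X·W(u,v) = Σₐ Σ_b uₐ v_b (d_b − dₐ) X^{dₐ + d_b}` (antisymmetrising the coefficient gives `Σ_{a<b} (uₐv_b − u_b vₐ)(d_b − dₐ) X^{dₐ+d_b}`).
[folklore (Cauchy–Binet for `det [[u,v],[θu,θv]]`); kernel form this work] -/
theorem X_mul_wronskian_fewnomial_eq {K : ℕ} (u v : Fin K → ℝ) (d : Fin K → ℕ) :
    (X : ℝ[X]) * wronskian (∑ l, C (u l) * X ^ d l) (∑ l, C (v l) * X ^ d l) =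
      ∑ a, ∑ b, C (u a * v b * ((d b : ℝ) - d a)) * X ^ (d a + d b) := by
  have hu := X_mul_derivative_fewnomial u d
  have hv := X_mul_derivative_fewnomial v d
  calc (X : ℝ[X]) * wronskian (∑ l, C (u l) * X ^ d l) (∑ l, C (v l) * X ^ d l)
      = (∑ l, C (u l) * X ^ d l) * (X * derivative (∑ l, C (v l) * X ^ d l)) -
          (X * derivative (∑ l, C (u l) * X ^ d l)) * (∑ l, C (v l) * X ^ d l) := by
        unfold wronskian; ring
    _ = ∑ a, ∑ b, C (u a * v b * ((d b : ℝ) - d a)) * X ^ (d a + d b) := by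
        rw [hu, hv, Finset.sum_mul_sum, Finset.sum_mul_sum, ← Finset.sum_sub_distrib]
        refine Finset.sum_congr rfl fun a _ => ?_
        rw [← Finset.sum_sub_distrib]
        refine Finset.sum_congr rfl fun b _ => ?_
        simp only [map_mul, map_sub, pow_add]
        ring

/-- **THE NON-NESTING BUDGET** (combinatorial half of the tropical Wronskian law).  A family `S` of pairs `(a, b)` with `a < b < K`
in which no two members are strictly nested — stated in the equivalent monotone form «`a < a′ ⇒ b ≤ b′`» — has at most `2K − 3` members:
along `S` both coordinates increase weakly, so `a + b` is injective on `S` with values in `[1, 2K − 3]`. [this work] -/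
theorem card_le_of_nonNesting (K : ℕ) (S : Finset (ℕ × ℕ))
    (hS : ∀ p ∈ S, p.1 < p.2 ∧ p.2 < K)
    (hmono : ∀ p ∈ S, ∀ q ∈ S, p.1 < q.1 → p.2 ≤ q.2) :
    S.card ≤ 2 * K - 3 := by
  -- `a + b` is injective on `S`
  have hinj : Set.InjOn (fun p : ℕ × ℕ => p.1 + p.2) S := by
    intro p hp q hq hpq
    simp only at hpq
    rcases lt_trichotomy p.1 q.1 with h | h | h
    · have := hmono p hp q hq h; omega
    · exact Prod.ext h (by omega)
    · have := hmono q hq p hp h; omega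
  -- and takes values in `[1, 2K − 3]`
  have hrange : S.image (fun p : ℕ × ℕ => p.1 + p.2) ⊆ Finset.Icc 1 (2 * K - 3) := by
    intro n hn
    rw [Finset.mem_image] at hn
    obtain ⟨p, hp, rfl⟩ := hn
    have := hS p hp
    rw [Finset.mem_Icc]; omega
  calc S.card = (S.image fun p : ℕ × ℕ => p.1 + p.2).card := (Finset.card_image_of_injOn hinj).symm
    _ ≤ (Finset.Icc 1 (2 * K - 3)).card := Finset.card_le_card hrange
    _ = 2 * K - 3 := by rw [Nat.card_Icc]; omega

/-- the non-nesting budget in the «no strictly nested pair» form: if no two members `(i,l), (j,k)` of `S` satisfy `i < j`, `k < l`,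
then `#S ≤ 2K − 3`. [this work] -/
theorem card_le_of_noNestedPair (K : ℕ) (S : Finset (ℕ × ℕ))
    (hS : ∀ p ∈ S, p.1 < p.2 ∧ p.2 < K)
    (hnn : ∀ p ∈ S, ∀ q ∈ S, ¬ (p.1 < q.1 ∧ q.2 < p.2)) :
    S.card ≤ 2 * K - 3 :=
  card_le_of_nonNesting K S hS fun p hp q hq h => by
    have := hnn p hp q hq
    omega

/-- sharpness of the budget: the fan-and-path family `{(0,b) : 0 < b < K} ∪ {(a, K−1) : 0 < a < K−1}` is non-nesting with
`2K − 3` members (`K ≥ 2`). [this work] -/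
theorem exists_nonNesting_card_eq (K : ℕ) (hK : 2 ≤ K) :
    ∃ S : Finset (ℕ × ℕ), (∀ p ∈ S, p.1 < p.2 ∧ p.2 < K) ∧
      (∀ p ∈ S, ∀ q ∈ S, ¬ (p.1 < q.1 ∧ q.2 < p.2)) ∧ S.card = 2 * K - 3 := by
  classical
  refine ⟨(Finset.Ico 1 K).image (fun b => (0, b)) ∪ (Finset.Ico 1 (K - 1)).image (fun a => (a, K - 1)), ?_, ?_, ?_⟩
  · intro p hp
    simp only [Finset.mem_union, Finset.mem_image, Finset.mem_Ico] at hp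
    rcases hp with ⟨b, hb, rfl⟩ | ⟨a, ha, rfl⟩ <;> simp only <;> omega
  · intro p hp q hq
    simp only [Finset.mem_union, Finset.mem_image, Finset.mem_Ico] at hp hq
    rcases hp with ⟨b, hb, rfl⟩ | ⟨a, ha, rfl⟩ <;> rcases hq with ⟨b', hb', rfl⟩ | ⟨a', ha', rfl⟩ <;> simp only <;> omega
  · rw [Finset.card_union_of_disjoint, Finset.card_image_of_injective _ fun b b' h => (Prod.ext_iff.mp h).2,
      Finset.card_image_of_injective _ fun a a' h => (Prod.ext_iff.mp h).1, Nat.card_Ico, Nat.card_Ico]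
    · omega
    · rw [Finset.disjoint_left]
      intro p hp hq
      simp only [Finset.mem_image, Finset.mem_Ico] at hp hq
      obtain ⟨b, hb, rfl⟩ := hp
      obtain ⟨a, ha, h⟩ := hq
      have := (Prod.ext_iff.mp h).1
      simp only at this
      omega

/-! ## §3 (rev 3) The Wronskian of two fewnomials IS an `m = 2` lacunary pencil determinant with RANK-ONE letters

`X·W(u,v) = det Σₗ X^{dₗ} • Sₗ` with the rank-one letters `Sₗ = (1, dₗ)ᵀ (uₗ, vₗ) = [[uₗ, vₗ],[dₗuₗ, dₗvₗ]]` (left factors on the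
moment curve `(1, dₗ)`, right factors the pencil's coefficient columns).  So the size-one inflection sector and the «Wronskian of two
fewnomials» question are, BY NAME, a sub-row of the census row `(2, d)` with rank-one letters — the tree's `RankOnePencils` ceiling
`Z₊ ≤ C(K,2) − 1` applies verbatim (`card_posRoots_wronskian_fewnomial_le_choose`), and the conjectured truth `2K − 4` (§2) is what the
TOTAL POSITIVITY of the left factors should buy below that ceiling.
-/

/-- the rank-one «Wronskian letters» `Sₗ = (1, dₗ)ᵀ ⊗ (uₗ, vₗ)`. (local notation-free abbreviation, not a definition of the line) -/
theorem wronskianLetter_apply {K : ℕ} (u v : Fin K → ℝ) (d : Fin K → ℕ) (l : Fin K) (i j : Fin 2) :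
    Matrix.vecMulVec ![(1 : ℝ), (d l : ℝ)] ![u l, v l] i j = ![(1 : ℝ), (d l : ℝ)] i * ![u l, v l] j := by
  simp [Matrix.vecMulVec_apply]

/-- **`X·W(u,v)` is the determinant of the `2 × 2` lacunary pencil with the rank-one Wronskian letters.** [this work] -/
theorem X_mul_wronskian_eq_det_pencil {K : ℕ} (u v : Fin K → ℝ) (d : Fin K → ℕ) :
    (X : ℝ[X]) * wronskian (∑ l, C (u l) * X ^ d l) (∑ l, C (v l) * X ^ d l) =
      Matrix.det (∑ l, ((X : ℝ[X]) ^ d l) • (Matrix.vecMulVec ![(1 : ℝ), (d l : ℝ)] ![u l, v l]).map C) := by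
  have hu := X_mul_derivative_fewnomial u d
  have hv := X_mul_derivative_fewnomial v d
  have hentry : ∀ i j : Fin 2, (∑ l, ((X : ℝ[X]) ^ d l) • (Matrix.vecMulVec ![(1 : ℝ), (d l : ℝ)] ![u l, v l]).map C) i j =
      ∑ l, C (![(1 : ℝ), (d l : ℝ)] i * ![u l, v l] j) * X ^ d l := by
    intro i j
    simp only [Matrix.sum_apply, Matrix.smul_apply, Matrix.map_apply, Matrix.vecMulVec_apply, smul_eq_mul]
    exact Finset.sum_congr rfl fun l _ => by ring
  rw [Matrix.det_fin_two, hentry, hentry, hentry, hentry]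
  simp only [Matrix.cons_val_zero, Matrix.cons_val_one, one_mul]
  calc (X : ℝ[X]) * wronskian (∑ l, C (u l) * X ^ d l) (∑ l, C (v l) * X ^ d l)
      = (∑ l, C (u l) * X ^ d l) * (X * derivative (∑ l, C (v l) * X ^ d l)) -
          (X * derivative (∑ l, C (u l) * X ^ d l)) * (∑ l, C (v l) * X ^ d l) := by
        unfold wronskian; ring
    _ = (∑ l, C (u l) * X ^ d l) * (∑ l, C ((d l : ℝ) * v l) * X ^ d l) -
          (∑ l, C (v l) * X ^ d l) * (∑ l, C ((d l : ℝ) * u l) * X ^ d l) := by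
        rw [hu, hv]
        have h1 : ∑ l, C (v l * (d l : ℝ)) * (X : ℝ[X]) ^ d l = ∑ l, C ((d l : ℝ) * v l) * X ^ d l :=
          Finset.sum_congr rfl fun l _ => by rw [mul_comm (v l)]
        have h2 : ∑ l, C (u l * (d l : ℝ)) * (X : ℝ[X]) ^ d l = ∑ l, C ((d l : ℝ) * u l) * X ^ d l :=
          Finset.sum_congr rfl fun l _ => by rw [mul_comm (u l)]
        rw [h1, h2]; ring

/-- the Wronskian letters have rank `≤ 1`. [Mathlib `Matrix.rank_vecMulVec_le`] -/
theorem rank_wronskianLetter_le {K : ℕ} (u v : Fin K → ℝ) (d : Fin K → ℕ) (l : Fin K) :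
    (Matrix.vecMulVec ![(1 : ℝ), (d l : ℝ)] ![u l, v l]).rank ≤ 1 :=
  Matrix.rank_vecMulVec_le _ _

/-- **Descartes ceiling for the Wronskian of two fewnomials, by name through the rank-one row**:
`Z₊(W(u,v)) ≤ C(K,2) − 1` (`RankOnePencils.card_posRoots_le_choose_sub_one_of_rank_le_one` at `m = 2`).  The conjectured truth is
`2K − 4` (§2). [this work] -/
theorem card_posRoots_wronskian_fewnomial_le_choose {K : ℕ} (u v : Fin K → ℝ) (d : Fin K → ℕ) :
    ((wronskian (∑ l, C (u l) * X ^ d l) (∑ l, C (v l) * X ^ d l)).roots.toFinset.filter (fun x => 0 < x)).card ≤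
      K.choose 2 - 1 := by
  rw [← card_posRoots_X_mul, X_mul_wronskian_eq_det_pencil]
  exact RankOnePencils.card_posRoots_le_choose_sub_one_of_rank_le_one d _ (rank_wronskianLetter_le u v d)

end InflectionLaw

end Summit.ValiantsHypothesis.ValiantsHypothesis.Theorems.KPlusLogSqLaw.TowerGraft
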